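/- Copyright: the b2b-balaban cell (near-miss cell 7), T⁴-continuum fan-out; row NE7b OWNER lineage `t4-ne7b-p1`
(gen 60) — «(d2′) ON THE COUNT SIDE: THE CHAIN CLOCK IS BOOKED», part 3 (print-exact pendency; kernel item of RULING
R-OWNER-60-1).  Released under the licence of the surrounding project. -/
import Summits.QuantumFields.BalabanUV.T4Continuum.Support.HistoryReadinessChainRealise

/-!
# Realised histories on print's CHAIN CLOCK with PRINT-EXACT join pendency (`PendingBefore`-style) ALSO stop strictly
inside the booked windows `dictW` — the two-box contraction lemma that closes the sub-case «both partners chain-ready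
exactly at the join scale» with `n₁ = 13` (row NE7b, R-OWNER-60-1, part 3; parts 1∕2 = `HistoryReadinessChainWindows` ∕
`HistoryReadinessChainRealise`)

Summits-side support leaf of the T⁴-continuum cell (rung (B)+1 on a FINITE torus only; NOT infinite volume, NOT the
mass gap, NOT the Clay statement; NOT a proof of the spine estimate NE7b — the cell's OWN estimate, NOT PRINTED, NOT
PROVED).  [folklore] finite combinatorics in the ℤᵈ INDEX MODEL over parts 1∕2, row S1b's `HistoryWindows` (`Boxed`,
`condI_from_add_two`'s alternation argument) and the Literature modules `B16Absorption` ∕ `B16MergeHorizon` ([K]); no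
`[cite:]` tag, no `Prop` fact of Bałaban's minted (the two `def`s are PREDICATES with parameters — the print-exact
pendency clause of `HistoryRealisePrint` (repair R-40-a) re-clocked), zero `sorry`.  B16 = [Balaban1989LargeFieldII]
pp. 384–387 is a manuscript UNDER AUDIT and appears only as a LOCATOR.

WHY.  Part 2 certified the chain clock against `dictW` on row S1b's join clause (partners chain-pending THROUGH the join
scale, own indices `K₁, K₂ ≥ 1`).  The print-exact clause of repair R-40-a (`HistoryRealisePrint.RealisesP`: partners
pending STRICTLY BEFORE the join scale — a component may become ready AT the scale at which it is merged, [B16] p. 387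
«K₁, K₂» arbitrary) admits `K₁ = 0` ∕ `K₂ = 0`.  One partner at `0` goes through `B16MergeHorizon.condI_union` with
`D = 100` inside `K₂ + 13`; BOTH at `0` — two (i)-small domains touching at the join scale — would cost `14 + N` with
`condI_union`'s generic constant (`max (s + 6) 14`), one more than the booked `n₁ = 13`.  §1 supplies the missing
geometry: the union of two touching (i)-small domains is boxed with width `≤ 199`, and along the flow (`L ≥ 3`, drop
control: no two consecutive no-gain steps) its images satisfy condition (i) at EVERY scale `≥ 4` (widths
`199 → {87 | 219} → {93 | 107} → {56 | 113} → {58 | 76}` by gaining `⌈w∕3⌉ + 20` ∕ non-gaining `w + 20` steps, then the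
invariant «`≤ 60`, or `≤ 80` right after a no-gain step» of `HistoryWindows.condI_from_add_two`), so the merged line
chain-stops at `4 + N ≤ 13 + N`.  Hence the print-exact chain-clock realisation theorem with the SAME letters
(`L ≥ 4`, `R ≥ 1`, `n₁ ≥ 13`, `dictW` untouched): the rider (d2′) is census-neutral on R-40-a's clauses too.

WHAT.  §1 `boxed_step`, `boxed_union_of_touch`, **`condI_from_four_of_boxed`**.  §2 **`stopAtC_join'`** (part 1's
`stopAtC_join` for ALL `K₁, K₂ ≥ 0`).  §3 `PendingBeforeC`, `RealisesPC`, `pendingBeforeC_of_pendingAtC`,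
`realisesPC_of_realisesC`; **`exists_stopC_lt_reach_P`** (MAIN), `lt_reach_of_pendingBeforeC`, `renew_lt_reach_PC`,
`joinInLife_of_realisesPC`, `adm_of_realisesPC`.  §4 sanity.

HONEST SCOPE.  Index-model combinatorics on hypothesis shapes; the process of record (clock `StopsM`) NOT edited, no
carrier twinned; nothing of Bałaban's asserted, instantiated or discharged; census NONE; R∕T rows by count UNCHANGED.
NE7b NOT PRINTED ∕ NOT PROVED; spine 0∕9.  HONEST DEPENDENCY (cell): continuum YM on T⁴ ⇐ BetaPertH ∧ nine spine
estimates (0/9 proved); BetaPertH ⇐ (D1) ∧ (D4) ∧ CAP+tail; G-an2-4 gates asym, D1 and NE2/3/4.  This file changes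
none of it.
-/

open Finset
open Literature.MathematicalPhysics.QuantumFieldTheory.Balaban1983to89
open Literature.MathematicalPhysics.QuantumFieldTheory.Balaban1983to89.B13ScaleTransfer
open Literature.MathematicalPhysics.QuantumFieldTheory.Balaban1983to89.TreeLength
open Literature.MathematicalPhysics.QuantumFieldTheory.Balaban1983to89.B16SProfile
open Literature.MathematicalPhysics.QuantumFieldTheory.Balaban1983to89.B16StoppingRule
open Literature.MathematicalPhysics.QuantumFieldTheory.Balaban1983to89.B16Absorption
open Literature.MathematicalPhysics.QuantumFieldTheory.Balaban1983to89.B16MergeGeometry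
open Literature.MathematicalPhysics.QuantumFieldTheory.Balaban1983to89.B16MergeHorizon
open T4PersistenceDictionary
open Summit.QuantumFields.BalabanUV.T4Continuum.HistoryAdmissible
open Summit.QuantumFields.BalabanUV.T4Continuum.HistoryWindows
open Summit.QuantumFields.BalabanUV.T4Continuum.HistoryRealise
open Summit.QuantumFields.BalabanUV.T4Continuum.HistoryReadinessChainScale
open Summit.QuantumFields.BalabanUV.T4Continuum.HistoryReadinessChainWindows
open Summit.QuantumFields.BalabanUV.T4Continuum.HistoryReadinessChainRealise

namespace Summit.QuantumFields.BalabanUV.T4Continuum.HistoryReadinessChainRealisePrint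

noncomputable section

variable {d : ℕ}

/-! ## §1 Two touching (i)-small domains: boxed with width `199`, (i)-small again from the fourth scale on -/

/-- **ONE STEP OF THE FLOW ON A BOXED SET**, both branches: a gaining step (ratio `≥ 2`, hence `≥ L ≥ 3`) contracts the
width to `≤ ⌈w∕3⌉ + 20`, a no-gain step (ratio `1`) widens it by `20`. [folklore] -/
theorem boxed_step {L : ℕ} (hL : 3 ≤ L) {σ : ℕ → ℕ} {X : ℕ → Finset (Pt d)}
    (hX : ∀ l, X (l + 1) = Sop (ratio L σ l) (X l)) {t : ℕ} {w : ℤ} (hw : 0 ≤ w) (hb : Boxed w (X t)) :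
    (2 ≤ ratio L σ t ∧ Boxed (cdiv w 3 + 20) (X (t + 1))) ∨ (¬ 2 ≤ ratio L σ t ∧ Boxed (w + 20) (X (t + 1))) := by
  by_cases hg : 2 ≤ ratio L σ t
  · left
    refine ⟨hg, ?_⟩
    have h := hb.sop_three (hL.trans (le_ratio_of_two_le hg)) hw
    rwa [← hX] at h
  · right
    refine ⟨hg, ?_⟩
    have hstep : X (t + 1) = Sop 1 (X t) := by rw [hX, ratio_eq_one_of_lt_two (by omega) hg]
    have h := hb.sop_one
    rwa [← hstep] at h

/-- **TWO TOUCHING (i)-SMALL DOMAINS ARE BOXED WITH WIDTH `199`** (`99 + 1 + 99`). [folklore] -/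
theorem boxed_union_of_touch {X Y : Finset (Pt d)} (hX : CondI 100 X) (hY : CondI 100 Y) {a c : Pt d} (ha : a ∈ X)
    (hc : c ∈ Y) (hac : Touch a c) : Boxed 199 (X ∪ Y) := by
  obtain ⟨lx, hx, hXb, hhx⟩ := exists_pbox_of_fitsIn hX
  obtain ⟨ly, hy, hYb, hhy⟩ := exists_pbox_of_fitsIn hY
  refine ⟨fun i => min (lx i) (ly i), fun i => max (hx i) (hy i), ?_, fun i => ?_⟩
  · intro z hz
    rw [mem_pbox]
    intro i
    rcases Finset.mem_union.mp hz with h | h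
    · have h1 := mem_pbox.mp (hXb h) i
      constructor <;> omega
    · have h1 := mem_pbox.mp (hYb h) i
      constructor <;> omega
  · have h1 := mem_pbox.mp (hXb ha) i
    have h2 := mem_pbox.mp (hYb hc) i
    have h3 := hac i
    have h4 := hhx i
    have h5 := hhy i
    push_cast at h4 h5
    dsimp only
    omega

/-- **A SET BOXED WITH WIDTH `199` IS (i)-SMALL FROM THE FOURTH SCALE ON.**  Along an iterate sequence of the flow
(`L ≥ 3`, drop control on the horizon `m`: no two consecutive no-gain steps, `B16MergeHorizon.altGain_ratio`): widths
`199 → {87 | 219} → {93 | 107} → {56 | 113} → {58 | 76}` (first alternative after a gaining step, second after a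
no-gain step, which forces the next step to gain), then the invariant «`≤ 60`, or `≤ 80` right after a no-gain step»;
so condition (i) (`100` cubes per side) holds at EVERY `4 ≤ l ≤ m`.  (At `l = 2, 3` it can fail: `107`, `113`.) [folklore] -/
theorem condI_from_four_of_boxed {L : ℕ} (hL : 3 ≤ L) {σ : ℕ → ℕ} {m : ℕ} (hσ : DropCtl σ m) {X : ℕ → Finset (Pt d)}
    (hX : ∀ l, X (l + 1) = Sop (ratio L σ l) (X l)) (h0 : Boxed 199 (X 0)) :
    ∀ l, 4 ≤ l → l ≤ m → CondI 100 (X l) := by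
  have halt := altGain_ratio (show 2 ≤ L by omega) hσ
  -- step 1
  have h1 : Boxed 87 (X 1) ∨ (¬ 2 ≤ ratio L σ 0 ∧ Boxed 219 (X 1)) := by
    rcases boxed_step hL hX (by norm_num) h0 with ⟨-, hb⟩ | ⟨hg, hb⟩
    · exact Or.inl (hb.mono (by norm_num [cdiv]))
    · exact Or.inr ⟨hg, hb.mono (by norm_num)⟩
  -- step 2
  have h2 : 2 ≤ m → Boxed 93 (X 2) ∨ (¬ 2 ≤ ratio L σ 1 ∧ Boxed 107 (X 2)) := fun hm => by
    rcases h1 with hb | ⟨hng, hb⟩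
    · rcases boxed_step hL hX (by norm_num) hb with ⟨-, hb'⟩ | ⟨hg, hb'⟩
      · exact Or.inl (hb'.mono (by norm_num [cdiv]))
      · exact Or.inr ⟨hg, hb'.mono (by norm_num)⟩
    · have hg : 2 ≤ ratio L σ 1 := (halt 0 (by omega)).resolve_left hng
      rcases boxed_step hL hX (by norm_num) hb with ⟨-, hb'⟩ | ⟨hng', -⟩
      · exact Or.inl (hb'.mono (by norm_num [cdiv]))
      · exact absurd hg hng'
  -- step 3
  have h3 : 3 ≤ m → Boxed 56 (X 3) ∨ (¬ 2 ≤ ratio L σ 2 ∧ Boxed 113 (X 3)) := fun hm => by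
    rcases h2 (by omega) with hb | ⟨hng, hb⟩
    · rcases boxed_step hL hX (by norm_num) hb with ⟨-, hb'⟩ | ⟨hg, hb'⟩
      · exact Or.inl (hb'.mono (by norm_num [cdiv]))
      · exact Or.inr ⟨hg, hb'.mono (by norm_num)⟩
    · have hg : 2 ≤ ratio L σ 2 := (halt 1 (by omega)).resolve_left hng
      rcases boxed_step hL hX (by norm_num) hb with ⟨-, hb'⟩ | ⟨hng', -⟩
      · exact Or.inl (hb'.mono (by norm_num [cdiv]))
      · exact absurd hg hng'
  -- step 4
  have h4 : 4 ≤ m → Boxed 58 (X 4) ∨ (¬ 2 ≤ ratio L σ 3 ∧ Boxed 76 (X 4)) := fun hm => by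
    rcases h3 (by omega) with hb | ⟨hng, hb⟩
    · rcases boxed_step hL hX (by norm_num) hb with ⟨-, hb'⟩ | ⟨hg, hb'⟩
      · exact Or.inl (hb'.mono (by norm_num [cdiv]))
      · exact Or.inr ⟨hg, hb'.mono (by norm_num)⟩
    · have hg : 2 ≤ ratio L σ 3 := (halt 2 (by omega)).resolve_left hng
      rcases boxed_step hL hX (by norm_num) hb with ⟨-, hb'⟩ | ⟨hng', -⟩
      · exact Or.inl (hb'.mono (by norm_num [cdiv]))
      · exact absurd hg hng'
  -- the invariant from the fourth scale on: width ≤ 60, or (last step did not gain ∧ width ≤ 80)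
  have inv : ∀ t, 4 + t ≤ m →
      Boxed 60 (X (4 + t)) ∨ (¬ 2 ≤ ratio L σ (3 + t) ∧ Boxed 80 (X (4 + t))) := by
    intro t
    induction t with
    | zero =>
        intro hm
        rcases h4 hm with hb | ⟨hng, hb⟩
        · exact Or.inl (hb.mono (by norm_num))
        · exact Or.inr ⟨hng, hb.mono (by norm_num)⟩
    | succ t ih =>
        intro ht
        have h45 : 4 + (t + 1) = (4 + t) + 1 := by omega
        have h34 : 3 + (t + 1) = 4 + t := by omega
        rw [h45, h34]
        rcases ih (by omega) with hb | ⟨hng, hb⟩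
        · rcases boxed_step hL hX (by norm_num) hb with ⟨-, hb'⟩ | ⟨hg, hb'⟩
          · exact Or.inl (hb'.mono (by norm_num [cdiv]))
          · exact Or.inr ⟨hg, hb'.mono (by norm_num)⟩
        · have hg : 2 ≤ ratio L σ (4 + t) := by
            rcases halt (3 + t) (by omega) with h | h
            · exact absurd h hng
            · rw [show 3 + t + 1 = 4 + t by omega] at h; exact h
          rcases boxed_step hL hX (by norm_num) hb with ⟨-, hb'⟩ | ⟨hng', -⟩
          · exact Or.inl (hb'.mono (by norm_num [cdiv]))
          · exact absurd hg hng'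
  intro l hl hlm
  obtain ⟨t, rfl⟩ : ∃ t, l = 4 + t := ⟨l - 4, by omega⟩
  apply condI_of_boxed
  rcases inv t hlm with hb | ⟨-, hb⟩
  · exact hb.mono (by norm_num)
  · exact hb.mono (by norm_num)

/-! ## §2 The join bound for ALL partner indices `K₁, K₂ ≥ 0` -/

/-- **THE JOIN CHAIN-STOPS WITHIN `max K₁ K₂ + 13 + N`, ALSO FOR PARTNERS READY AT THE JOIN SCALE** (`K₁ = 0` ∕ `K₂ = 0`
admitted; hypotheses as part 1's `stopAtC_join`, whose `K − 1` is truncated subtraction): both indices `≥ 1` — part 1;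
exactly one at `0` — that partner is (i)-small AT the join scale, `condI_union` with `D = 100` inside `K + 13`; both at
`0` — §1: the union is (i)-small at every scale `≥ 4`, chain-stop at `4 + N`. [folklore] -/
theorem stopAtC_join' {L : ℕ} (hL : 3 ≤ L) {σ : ℕ → ℕ} {m' : ℕ} (hσ : DropCtl σ m')
    {X Y : Finset (Pt d)} {a c : Pt d} (ha : a ∈ X) (hc : c ∈ Y) (hac : Touch a c) {K₁ K₂ : ℕ}
    (hXI : ∀ m, K₁ - 1 ≤ m → CondI 100 (Siter (ratio L σ) m X))
    (hYI : ∀ m, K₂ - 1 ≤ m → CondI 100 (Siter (ratio L σ) m Y))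
    {N : ℕ} (Clean : ℕ → Prop) (hclean : ∀ l, 1 ≤ l → l ≤ m' → Clean l)
    (hm : max K₁ K₂ + 13 + N ≤ m') :
    ∃ k, 1 ≤ k ∧ k ≤ max K₁ K₂ + 13 + N ∧ StopAtC 100 N Clean (fun l => Siter (ratio L σ) l (X ∪ Y)) k := by
  have hL2 : 2 ≤ L := by omega
  -- a scale `m₀ ≤ max K₁ K₂ + 13`, `m₀ ≥ 1`, from which the union satisfies (i) on the horizon — or part 1 directly
  rcases Nat.eq_zero_or_pos K₁ with h1 | h1 <;> rcases Nat.eq_zero_or_pos K₂ with h2 | h2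
  rotate_right
  · exact stopAtC_join hL2 hσ ha hc hac h1 h2 hXI hYI Clean hclean hm
  all_goals
    obtain ⟨m₀, hm₀1, hm₀, hU⟩ : ∃ m₀, 1 ≤ m₀ ∧ m₀ ≤ max K₁ K₂ + 13 ∧
        ∀ mm, m₀ ≤ mm → mm ≤ m' → CondI 100 (Siter (ratio L σ) mm (X ∪ Y)) := by
      first
      | -- both partners small at the join scale
        subst h1; subst h2
        have hX0 : CondI 100 X := by simpa using hXI 0 (by omega)
        have hY0 : CondI 100 Y := by simpa using hYI 0 (by omega)
        refine ⟨4, by omega, by omega, fun mm hmm hmm' => ?_⟩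
        exact condI_from_four_of_boxed hL hσ (X := fun l => Siter (ratio L σ) l (X ∪ Y)) (fun l => rfl)
          (boxed_union_of_touch hX0 hY0 ha hc hac) mm hmm hmm'
      | -- `X` small at the join scale, `Y` small at `K₂ ≥ 1`
        subst h1
        have hX0 : CondI 100 X := by simpa using hXI 0 (by omega)
        refine ⟨max (K₂ + 6) 14, by omega, by omega, fun mm hmm hmm' => ?_⟩
        exact condI_union hL2 hσ hc (D := 100) (by norm_num) (by norm_num) (near_of_condI_touch hX0 ha hac)
          (s := K₂) (hYI K₂ (by omega)) (by omega) (by omega) hmm'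
      | -- `Y` small at the join scale, `X` small at `K₁ ≥ 1`
        subst h2
        have hY0 : CondI 100 Y := by simpa using hYI 0 (by omega)
        refine ⟨max (K₁ + 6) 14, by omega, by omega, fun mm hmm hmm' => ?_⟩
        have h := condI_union hL2 hσ ha (D := 100) (by norm_num) (by norm_num) (near_of_condI_touch hY0 hc hac.symm)
          (s := K₁) (hXI K₁ (by omega)) (by omega) (by omega) hmm'
        simpa only [union_comm] using h
    refine ⟨m₀ + N, by omega, by omega, ⟨by omega, hU _ (by omega) (by omega), by omega,
      fun l hl1 hl2 => ⟨hclean l (by omega) (by omega), hU l (by omega) (by omega)⟩⟩, ?_⟩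
    show CondI 100 (Siter (ratio L σ) (m₀ + N - N) (X ∪ Y))
    rw [Nat.add_sub_cancel]
    exact hU m₀ le_rfl (by omega)

/-! ## §3 Print-exact pendency on the chain clock, and the main theorem -/

/-- **`PendingBeforeC L s R t₀ Z K`**: the domain formed at `t₀ ≤ K` has not CHAIN-stopped at any index STRICTLY BELOW
`K − t₀` (the print-exact pendency of `HistoryRealisePrint.PendingBefore`, re-clocked). [folklore] -/
def PendingBeforeC (L : ℕ) (s : ℕ → ℕ) (R : ℕ → ℕ) (t₀ : ℕ) (Z : Finset (Pt d)) (K : ℕ) : Prop :=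
  t₀ ≤ K ∧ ∀ k, k < K - t₀ → ¬ StopsC L s R t₀ Z k

/-- chain-pendency through a scale implies chain-pendency strictly before it [folklore] -/
theorem pendingBeforeC_of_pendingAtC {L : ℕ} {s R : ℕ → ℕ} {t₀ : ℕ} {Z : Finset (Pt d)} {K : ℕ}
    (h : PendingAtC L s R t₀ Z K) : PendingBeforeC L s R t₀ Z K :=
  ⟨h.1, fun k hk => h.2 k hk.le⟩

/-- **REALISED HISTORIES ON THE CHAIN CLOCK, PRINT-EXACT JOINS**: `RealisesC` of part 2 with the join partners
chain-pending STRICTLY BEFORE the join scale (they may become chain-ready AT the scale at which they are merged). [folklore] -/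
def RealisesPC (L : ℕ) (s : ℕ → ℕ) (R : ℕ → ℕ) : PGen (Pt d × Finset (Pt d)) → Finset (Pt d) → Prop
  | .birth _ cls zZ, Z => zZ.2 = Z ∧ zZ.1 ∈ Z ∧ FaceConnected Z ∧ treeLen Z ≤ cls
  | .renew G h, Z => ∃ ZG, RealisesPC L s R G ZG ∧ StopsC L s R G.lastStep ZG (h - G.lastStep) ∧
      (∀ k, k < h - G.lastStep → ¬ StopsC L s R G.lastStep ZG k) ∧ Z = orbit L s G.lastStep ZG (h + 1 - G.lastStep)
  | .join X Y sj, Z => ∃ ZX ZY, RealisesPC L s R X ZX ∧ RealisesPC L s R Y ZY ∧ X.lastStep ≤ sj ∧ Y.lastStep ≤ sj ∧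
      PendingBeforeC L s R X.lastStep ZX sj ∧ PendingBeforeC L s R Y.lastStep ZY sj ∧
      (∃ a ∈ orbit L s X.lastStep ZX (sj - X.lastStep), ∃ c ∈ orbit L s Y.lastStep ZY (sj - Y.lastStep), Touch a c) ∧
      Z ⊆ orbit L s X.lastStep ZX (sj - X.lastStep) ∪ orbit L s Y.lastStep ZY (sj - Y.lastStep)

/-- part 2's predicate implies the print-exact one (it asks more of the join partners). [folklore] -/
theorem realisesPC_of_realisesC {L : ℕ} {s R : ℕ → ℕ} :
    ∀ (P : PGen (Pt d × Finset (Pt d))) (Z : Finset (Pt d)), RealisesC L s R P Z → RealisesPC L s R P Z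
  | .birth _ _ _, _, h => h
  | .renew G h, Z, hP => by
      obtain ⟨ZG, hG, hready, hfirst, hZ⟩ := hP
      exact ⟨ZG, realisesPC_of_realisesC G ZG hG, hready, hfirst, hZ⟩
  | .join X Y sj, Z, hP => by
      obtain ⟨ZX, ZY, hX, hY, htX, htY, hpX, hpY, hac, hZ⟩ := hP
      exact ⟨ZX, ZY, realisesPC_of_realisesC X ZX hX, realisesPC_of_realisesC Y ZY hY, htX, htY,
        pendingBeforeC_of_pendingAtC hpX, pendingBeforeC_of_pendingAtC hpY, hac, hZ⟩

section Main

variable {L : ℕ} {s R : ℕ → ℕ} (hL : 4 ≤ L) (hdrop : ∀ m, DropCtl s m) (hR : ∀ t, 1 ≤ R t) {n₁ : ℕ} (hn₁ : 13 ≤ n₁)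
include hL hdrop hR hn₁

/-- **MAIN THEOREM, PRINT-EXACT FORM ON THE CHAIN CLOCK.**  Every `RealisesPC`-realised history chain-stops at some
`k ≥ 1` with `lastStep + k < toGen.reach (dictW R n₁)` (`L ≥ 4`, drop control, sizes `R ≥ 1`, allowance `n₁ ≥ 13`;
`dictW` untouched).  Part 2's proof verbatim except in the join case, where the partners' chain-stops now lie AT OR AFTER
the join scale and `stopAtC_join'` (§2) absorbs the indices `0`. [folklore] -/
theorem exists_stopC_lt_reach_P :
    ∀ (P : PGen (Pt d × Finset (Pt d))) (Z : Finset (Pt d)), RealisesPC L s R P Z →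
      ∃ k, 1 ≤ k ∧ StopsC L s R P.lastStep Z k ∧ P.lastStep + k < P.toGen.reach (dictW R n₁)
  | .birth j cls zZ, Z, hRZ => exists_stopC_lt_reach hL hdrop hR hn₁ (.birth j cls zZ) Z hRZ
  | .renew G h, Z, hRZ => by
      obtain ⟨ZG, -, hready, -, rfl⟩ := hRZ
      -- the renewal case reads nothing off the history of `G`: part 2's history-free `stopsC_renew`
      refine ⟨R (h + 1), hR (h + 1), stopsC_renew hL hdrop hR hready, ?_⟩
      have := hready.pos
      have h1 := restart_lt_dictW R n₁ (h + 1)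
      simp only [PGen.lastStep, PGen.toGen, Gen.reach_renew]
      omega
  | .join X Y sj, Z, hRZ => by
      obtain ⟨ZX, ZY, hX, hY, htX, htY, hpX, hpY, ⟨a, ha, c, hc, hac⟩, hZ⟩ := hRZ
      obtain ⟨kX, hkX1, hsX, hrX⟩ := exists_stopC_lt_reach_P X ZX hX
      obtain ⟨kY, hkY1, hsY, hrY⟩ := exists_stopC_lt_reach_P Y ZY hY
      set tX := X.lastStep
      set tY := Y.lastStep
      -- partners chain-pending strictly before the join: their chain-stops lie at or after `sj`
      have hKX : sj - tX ≤ kX := by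
        by_contra hlt; exact hpX.2 kX (by omega) hsX
      have hKY : sj - tY ≤ kY := by
        by_contra hlt; exact hpY.2 kY (by omega) hsY
      have hXI : ∀ m, tX + kX - sj - 1 ≤ m →
          CondI 100 (Siter (ratio L fun i => s (sj + i)) m (orbit L s tX ZX (sj - tX))) := by
        intro m hm
        have h := condI_orbit_of_stopsC hL hdrop hR hsX ((sj - tX) + m) (by omega)
        rw [orbit_add, show tX + (sj - tX) = sj by omega] at h
        exact h
      have hYI : ∀ m, tY + kY - sj - 1 ≤ m →
          CondI 100 (Siter (ratio L fun i => s (sj + i)) m (orbit L s tY ZY (sj - tY))) := by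
        intro m hm
        have h := condI_orbit_of_stopsC hL hdrop hR hsY ((sj - tY) + m) (by omega)
        rw [orbit_add, show tY + (sj - tY) = sj by omega] at h
        exact h
      obtain ⟨k, hk1, hkle, hstop⟩ := stopAtC_join' (show 3 ≤ L by omega)
        (dropCtl_from hdrop sj (max (tX + kX - sj) (tY + kY - sj) + 13 + R sj)) ha hc hac
        (K₁ := tX + kX - sj) (K₂ := tY + kY - sj)
        (fun m hm => hXI m (by omega)) (fun m hm => hYI m (by omega)) (N := R sj) (fun _ => True)
        (fun _ _ _ => trivial) le_rfl
      refine ⟨k, hk1, ?_, ?_⟩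
      · apply StopsC.subset hZ
        show StopAtC 100 (R sj) (fun _ => True)
          (orbit L s sj (orbit L s tX ZX (sj - tX) ∪ orbit L s tY ZY (sj - tY))) k
        exact hstop
      · have h := join_lt_dictW R hn₁ sj (r₁ := X.toGen.reach (dictW R n₁)) (r₂ := Y.toGen.reach (dictW R n₁)) hkle
          (by omega) (by omega)
        simp only [PGen.lastStep, PGen.toGen, Gen.reach_merge]
        exact h

/-- **CHAIN-PENDING STRICTLY BEFORE THE CUTOFF ⇒ INSIDE THE BOOKED LIFE**: `K < toGen.reach (dictW R n₁)` — the same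
conclusion as part 2's `lt_reach_of_pendingAtC` from the weaker, print-exact cutoff clause. [folklore] -/
theorem lt_reach_of_pendingBeforeC {P : PGen (Pt d × Finset (Pt d))} {Z : Finset (Pt d)} (hP : RealisesPC L s R P Z)
    {K : ℕ} (hK : PendingBeforeC L s R P.lastStep Z K) : K < P.toGen.reach (dictW R n₁) := by
  obtain ⟨k, -, hs, hlt⟩ := exists_stopC_lt_reach_P hL hdrop hR hn₁ P Z hP
  have : K - P.lastStep ≤ k := by
    by_contra hlt'; exact hK.2 k (by omega) hs
  have := hK.1
  omega

/-- a renewal happens strictly inside the booked life of the renewed line (print-exact chain-clock form) [folklore] -/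
theorem renew_lt_reach_PC {G : PGen (Pt d × Finset (Pt d))} {h : ℕ} {Z : Finset (Pt d)}
    (hP : RealisesPC L s R (.renew G h) Z) : h < G.toGen.reach (dictW R n₁) := by
  obtain ⟨ZG, hG, hready, hfirst, -⟩ := hP
  obtain ⟨k, -, hs, hlt⟩ := exists_stopC_lt_reach_P hL hdrop hR hn₁ G ZG hG
  have : h - G.lastStep ≤ k := by
    by_contra hlt'; exact hfirst k (by omega) hs
  have := hready.pos
  omega

/-- **`JoinInLife`, PRINT-EXACT CHAIN-CLOCK FORM**: every join happens inside both partners' booked lives. [folklore] -/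
theorem joinInLife_of_realisesPC :
    ∀ (P : PGen (Pt d × Finset (Pt d))) (Z : Finset (Pt d)), RealisesPC L s R P Z → P.JoinInLife (dictW R n₁)
  | .birth _ _ _, _, _ => trivial
  | .renew G h, Z, hP => by
      obtain ⟨ZG, hG, -, -, -⟩ := hP
      exact joinInLife_of_realisesPC G ZG hG
  | .join X Y sj, Z, hP => by
      obtain ⟨ZX, ZY, hX, hY, -, -, hpX, hpY, -, -⟩ := hP
      exact ⟨joinInLife_of_realisesPC X ZX hX, joinInLife_of_realisesPC Y ZY hY,
        lt_reach_of_pendingBeforeC hL hdrop hR hn₁ hX hpX, lt_reach_of_pendingBeforeC hL hdrop hR hn₁ hY hpY⟩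

end Main

/-- **`Adm`, PRINT-EXACT CHAIN-CLOCK FORM**: the timing discipline of the skeleton. [folklore] -/
theorem adm_of_realisesPC {L : ℕ} {s R : ℕ → ℕ} :
    ∀ (P : PGen (Pt d × Finset (Pt d))) (Z : Finset (Pt d)), RealisesPC L s R P Z →
      ∀ {K : ℕ}, P.lastStep ≤ K → P.Adm K
  | .birth _ _ _, _, _, _, hK => hK
  | .renew G h, Z, hP, K, hK => by
      obtain ⟨ZG, hG, hready, -, -⟩ := hP
      have := hready.pos
      simp only [PGen.lastStep] at hK
      exact ⟨adm_of_realisesPC G ZG hG (by omega), by omega, hK⟩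
  | .join X Y sj, Z, hP, K, hK => by
      obtain ⟨ZX, ZY, hX, hY, htX, htY, -, -, -, -⟩ := hP
      exact ⟨adm_of_realisesPC X ZX hX (htX.trans hK), adm_of_realisesPC Y ZY hY (htY.trans hK), htX, htY, hK⟩

/-! ## §4 Sanity -/

namespace Sanity

open B16MergeGeometry.OneDim

/-- the unit region is `RealisesPC`-realised [folklore] -/
theorem realisesPC_unit (L : ℕ) (s R : ℕ → ℕ) : RealisesPC L s R HistoryRealise.Sanity.unit {pt 0} :=
  realisesPC_of_realisesC _ _ (HistoryReadinessChainRealise.Sanity.realisesC_unit L s R)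

/-- a numeric instance of the main theorem's letters (`L = 13`, constant exponents, `R ≡ 2`, `n₁ = 13`). [folklore] -/
example : ∃ k, 1 ≤ k ∧ StopsC 13 (fun _ => 0) (fun _ => 2) 0 ({pt 0} : Finset (Pt 1)) k ∧
    0 + k < (HistoryRealise.Sanity.unit).toGen.reach (dictW (fun _ => 2) 13) :=
  exists_stopC_lt_reach_P (by norm_num) (fun m i k _ _ => by simp) (fun _ => by norm_num) le_rfl
    HistoryRealise.Sanity.unit {pt 0} (realisesPC_unit 13 _ _)

end Sanity

end

end Summit.QuantumFields.BalabanUV.T4Continuum.HistoryReadinessChainRealisePrint
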